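import Literature.Analysis.SpecialFunctions.TricomiIntegral
import Mathlib.MeasureTheory.Integral.DominatedConvergence
import Mathlib.Analysis.Calculus.MeanValue

/-!
# The large-argument behaviour of Tricomi's `U` along the positive real axis:
# `x^a U(a,b,x) → 1` as `x → +∞`, with an explicit `O(1/x)` remainder

For `Re a > 0` (and any complex `b`) the substitution `t = u/x` in the integral representation
DLMF 13.4.4 (`TricomiIntegral.lean`) gives, for real `x > 0`,

  `x^a ∫₀^∞ e^{−xt} t^{a−1}(1+t)^{b−a−1} dt = ∫₀^∞ e^{−u} u^{a−1} (1 + u/x)^{b−a−1} du`,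

and dominated convergence (`(1 + u/x)^{b−a−1} → 1`, dominated for `x ≥ 1` by the modulus of the
Tricomi integrand at `z = 1` with the exponent of `1+u` raised to `p = max (Re(b−a−1)) 0`) shows
that the right-hand side tends to `Γ(a)`. Hence the FIRST TERM of DLMF 13.7.3 on the real axis:

  `x^a U(a,b,x) → 1`   (`x → +∞`),        i.e. `U(a,b,x) ∼ x^{−a}`,

and, by the mean value inequality `‖(1+v)^c − 1‖ ≤ ‖c‖ v (1+v)^{max(Re c − 1, 0)}` (`v ≥ 0`), the
explicit remainder `‖x^a U(a,b,x) − 1‖ ≤ C/x` for `x ≥ 1` with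
`C = ‖b−a−1‖ · ∫₀^∞ e^{−u} u^{Re a}(1+u)^{max(Re(b−a−1)−1,0)} du / ‖Γ(a)‖`.

Contents: `tricomiIntegral_ofReal_scaling` (the substitution), `norm_tricomi_scaledIntegrand_le`,
`tendsto_tricomi_scaledIntegral` (`→ Γ(a)`), `tendsto_cpow_mul_tricomiU_atTop`;
`norm_one_add_cpow_sub_one_le`, `norm_tricomi_scaledIntegral_sub_Gamma_le`,
`norm_cpow_mul_tricomiU_sub_one_le` (the `O(1/x)` bound). NOT here: higher terms of 13.7.3,
complex `z → ∞` in the sector `|ph z| < 3π/2` (13.7.3 proper) — in particular the ray `z = −2iρ`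
of the Coulomb problem is not treated.

References: NIST DLMF 13.4.4, 13.7.3 [DLMF].
-/

noncomputable section

open Filter Metric MeasureTheory Set
open scoped Topology

namespace Literature.Analysis.SpecialFunctions.Confluent

/-! ### The substitution `t = u/x` -/

/-- For `u ≥ 0`, `x > 0`: `1 + u/x` lies in the slit plane (as a complex number). [folklore] -/
theorem one_add_div_mem_slitPlane {u x : ℝ} (hu : 0 ≤ u) (hx : 0 < x) :
    1 + (u : ℂ) / (x : ℂ) ∈ Complex.slitPlane := by
  have h : 1 + (u : ℂ) / (x : ℂ) = ((1 + u / x : ℝ) : ℂ) := by push_cast; ring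
  rw [h, Complex.ofReal_mem_slitPlane]
  positivity

/-- **The substitution `t = u/x`** in DLMF 13.4.4 (real `x > 0`):
`x^a ∫₀^∞ e^{−xt} t^{a−1}(1+t)^{b−a−1} dt = ∫₀^∞ e^{−u} u^{a−1}(1 + u/x)^{b−a−1} du`.
[cite: DLMF, 13.4.4] -/
theorem tricomiIntegral_ofReal_scaling (a b : ℂ) {x : ℝ} (hx : 0 < x) :
    (x : ℂ) ^ a * tricomiIntegral a b x =
      ∫ u in Ioi (0 : ℝ), Complex.exp (-(u : ℂ)) * (u : ℂ) ^ (a - 1) *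
        (1 + (u : ℂ) / (x : ℂ)) ^ (b - a - 1) := by
  have hx0 : (x : ℂ) ≠ 0 := Complex.ofReal_ne_zero.2 hx.ne'
  have hsub := integral_comp_mul_left_Ioi (fun u : ℝ => Complex.exp (-(u : ℂ)) * (u : ℂ) ^ (a - 1) *
    (1 + (u : ℂ) / (x : ℂ)) ^ (b - a - 1)) 0 hx
  rw [mul_zero] at hsub
  have hL : (∫ t in Ioi (0 : ℝ), (fun u : ℝ => Complex.exp (-(u : ℂ)) * (u : ℂ) ^ (a - 1) *
      (1 + (u : ℂ) / (x : ℂ)) ^ (b - a - 1)) (x * t)) =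
      (x : ℂ) ^ (a - 1) * tricomiIntegral a b x := by
    rw [tricomiIntegral, ← integral_const_mul]
    refine setIntegral_congr_fun measurableSet_Ioi fun t (ht : 0 < t) => ?_
    simp only [tricomiIntegrand]
    rw [Complex.ofReal_mul, Complex.mul_cpow_ofReal_nonneg hx.le ht.le,
      mul_div_cancel_left₀ _ hx0]
    ring
  rw [hL] at hsub
  have hxa : (x : ℂ) ^ ((a - 1) + 1) = (x : ℂ) ^ (a - 1) * x := by
    rw [Complex.cpow_add _ _ hx0, Complex.cpow_one]
  rw [sub_add_cancel] at hxa
  calc (x : ℂ) ^ a * tricomiIntegral a b x = x * ((x : ℂ) ^ (a - 1) * tricomiIntegral a b x) := by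
        rw [hxa]; ring
    _ = _ := by
        rw [hsub, Complex.real_smul, Complex.ofReal_inv, ← mul_assoc, mul_inv_cancel₀ hx0, one_mul]

/-! ### The rescaled integrand: modulus, domination, convergence -/

/-- The modulus of the rescaled integrand: for `u > 0`, `x > 0`,
`‖e^{−u} u^{a−1}(1 + u/x)^{c}‖ = e^{−u} u^{Re a − 1} (1 + u/x)^{Re c}`. [folklore] -/
theorem norm_tricomi_scaledIntegrand (a c : ℂ) {u x : ℝ} (hu : 0 < u) (hx : 0 < x) :
    ‖Complex.exp (-(u : ℂ)) * (u : ℂ) ^ (a - 1) * (1 + (u : ℂ) / (x : ℂ)) ^ c‖ =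
      Real.exp (-u) * u ^ (a.re - 1) * (1 + u / x) ^ c.re := by
  have h1 : 1 + (u : ℂ) / (x : ℂ) = ((1 + u / x : ℝ) : ℂ) := by push_cast; ring
  rw [norm_mul, norm_mul, Complex.norm_exp, h1, Complex.norm_cpow_eq_rpow_re_of_pos hu,
    Complex.norm_cpow_eq_rpow_re_of_pos (by positivity)]
  simp

/-- The rescaled integrand is continuous on `(0,∞)` for `x > 0`. [folklore] -/
theorem continuousOn_tricomi_scaledIntegrand (a c : ℂ) {x : ℝ} (hx : 0 < x) :
    ContinuousOn (fun u : ℝ => Complex.exp (-(u : ℂ)) * (u : ℂ) ^ (a - 1) *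
      (1 + (u : ℂ) / (x : ℂ)) ^ c) (Ioi 0) := by
  intro u hu
  have hu' : 0 < u := hu
  have h0 : ContinuousAt (fun v : ℝ => Complex.exp (-(v : ℂ))) u := by fun_prop
  have h1 : ContinuousAt (fun v : ℝ => (v : ℂ) ^ (a - 1)) u :=
    (continuousAt_cpow_const (Complex.ofReal_mem_slitPlane.2 hu')).comp
      Complex.continuous_ofReal.continuousAt
  have h2 : ContinuousAt (fun v : ℝ => (1 + (v : ℂ) / (x : ℂ)) ^ c) u :=
    ContinuousAt.cpow (f := fun v : ℝ => 1 + (v : ℂ) / (x : ℂ)) (g := fun _ => c)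
      (by fun_prop) continuousAt_const (one_add_div_mem_slitPlane hu'.le hx)
  exact ((h0.mul h1).mul h2).continuousWithinAt

/-- **Domination for `x ≥ 1`**: `‖e^{−u} u^{a−1}(1 + u/x)^{b−a−1}‖ ≤ ‖F(a, a+1+p; 1; u)‖`
(`F = tricomiIntegrand`, `p = max (Re(b−a−1)) 0`, `u > 0`), an integrable function of `u`.
[folklore] -/
theorem norm_tricomi_scaledIntegrand_le (a b : ℂ) {u x : ℝ} (hu : 0 < u) (hx : 1 ≤ x) :
    ‖Complex.exp (-(u : ℂ)) * (u : ℂ) ^ (a - 1) * (1 + (u : ℂ) / (x : ℂ)) ^ (b - a - 1)‖ ≤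
      ‖tricomiIntegrand a (a + 1 + (max (b.re - a.re - 1) 0 : ℝ)) 1 u‖ := by
  set p : ℝ := max (b.re - a.re - 1) 0 with hp
  have hp0 : 0 ≤ p := le_max_right _ _
  have hx0 : 0 < x := by linarith
  rw [norm_tricomi_scaledIntegrand a (b - a - 1) hu hx0, norm_tricomiIntegrand a (a + 1 + p) 1 hu]
  have hre : (a + 1 + (p : ℂ)).re - a.re - 1 = p := by simp; ring
  rw [hre, Complex.one_re, one_mul]
  have hux : u / x ≤ u := div_le_self hu.le hx
  have hBp : (b - a - 1).re ≤ p := by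
    simp only [Complex.sub_re, Complex.one_re]
    exact le_max_left _ _
  have h1 : (1 + u / x) ^ (b - a - 1).re ≤ (1 + u) ^ p :=
    (Real.rpow_le_rpow_of_exponent_le (by simp; positivity) hBp).trans
      (Real.rpow_le_rpow (by positivity) (by linarith) hp0)
  have hE : 0 ≤ Real.exp (-u) * u ^ (a.re - 1) := by positivity
  exact mul_le_mul_of_nonneg_left h1 hE

/-- The rescaled integrand is integrable on `(0,∞)` for `Re a > 0`, `x ≥ 1`. [folklore] -/
theorem integrableOn_tricomi_scaledIntegrand {a : ℂ} (b : ℂ) (ha : 0 < a.re) {x : ℝ} (hx : 1 ≤ x) :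
    IntegrableOn (fun u : ℝ => Complex.exp (-(u : ℂ)) * (u : ℂ) ^ (a - 1) *
      (1 + (u : ℂ) / (x : ℂ)) ^ (b - a - 1)) (Ioi 0) :=
  Integrable.mono' (integrableOn_tricomiIntegrand (a + 1 + _) ha (by simp)).norm
    ((continuousOn_tricomi_scaledIntegrand a _ (by linarith)).aestronglyMeasurable
      measurableSet_Ioi)
    ((ae_restrict_iff' measurableSet_Ioi).2 (ae_of_all _ fun _ hu =>
      norm_tricomi_scaledIntegrand_le a b hu hx))

/-- `Γ(a) = ∫₀^∞ e^{−u} u^{a−1} du` for `Re a > 0`, in the `Complex.exp` form used here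
(Mathlib's `Complex.Gamma_eq_integral`). [folklore] -/
theorem Gamma_eq_integral_exp_mul_cpow {a : ℂ} (ha : 0 < a.re) :
    Complex.Gamma a = ∫ u in Ioi (0 : ℝ), Complex.exp (-(u : ℂ)) * (u : ℂ) ^ (a - 1) := by
  have h := Complex.integral_cpow_mul_exp_neg_mul_Ioi ha one_pos
  simp only [Complex.ofReal_one, one_mul, div_one, Complex.one_cpow] at h
  rw [← h]
  refine setIntegral_congr_fun measurableSet_Ioi fun u _ => ?_
  ring

/-- **Dominated convergence**: for `Re a > 0`,
`∫₀^∞ e^{−u} u^{a−1}(1 + u/x)^{b−a−1} du → Γ(a)` as real `x → +∞`. [cite: DLMF, 13.7.3] -/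
theorem tendsto_tricomi_scaledIntegral {a : ℂ} (b : ℂ) (ha : 0 < a.re) :
    Tendsto (fun x : ℝ => ∫ u in Ioi (0 : ℝ), Complex.exp (-(u : ℂ)) * (u : ℂ) ^ (a - 1) *
        (1 + (u : ℂ) / (x : ℂ)) ^ (b - a - 1)) atTop (𝓝 (Complex.Gamma a)) := by
  rw [Gamma_eq_integral_exp_mul_cpow ha]
  refine tendsto_integral_filter_of_dominated_convergence
    (fun u : ℝ => ‖tricomiIntegrand a (a + 1 + (max (b.re - a.re - 1) 0 : ℝ)) 1 u‖) ?_ ?_ ?_ ?_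
  · exact Filter.eventually_of_mem (Ioi_mem_atTop 0) fun x (hx : 0 < x) =>
      (continuousOn_tricomi_scaledIntegrand a _ hx).aestronglyMeasurable measurableSet_Ioi
  · exact Filter.eventually_of_mem (Ici_mem_atTop 1) fun x (hx : 1 ≤ x) =>
      (ae_restrict_iff' measurableSet_Ioi).2 (ae_of_all _ fun u (hu : 0 < u) =>
        norm_tricomi_scaledIntegrand_le a b hu hx)
  · exact (integrableOn_tricomiIntegrand _ ha (by simp)).norm
  · -- pointwise limit `(1 + u/x)^{b−a−1} → 1`
    refine (ae_restrict_iff' measurableSet_Ioi).2 (ae_of_all _ fun u (_ : 0 < u) => ?_)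
    have h1 : Tendsto (fun x : ℝ => 1 + (u : ℂ) / (x : ℂ)) atTop (𝓝 1) := by
      have h : Tendsto (fun x : ℝ => ((1 + u / x : ℝ) : ℂ)) atTop (𝓝 ((1 + 0 : ℝ) : ℂ)) :=
        (Complex.continuous_ofReal.tendsto _).comp
          (tendsto_const_nhds.add (tendsto_const_nhds.div_atTop tendsto_id))
      simp only [add_zero, Complex.ofReal_one] at h
      refine h.congr fun x => ?_
      push_cast
      ring
    have h2 : Tendsto (fun x : ℝ => (1 + (u : ℂ) / (x : ℂ)) ^ (b - a - 1)) atTop (𝓝 1) := by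
      have h := ((continuousAt_cpow_const (b := b - a - 1) Complex.one_mem_slitPlane).tendsto).comp h1
      simpa only [Function.comp_def, Complex.one_cpow] using h
    simpa only [mul_one] using h2.const_mul (Complex.exp (-(u : ℂ)) * (u : ℂ) ^ (a - 1))

/-- **DLMF 13.7.3, first term, on the positive real axis**: for `Re a > 0` and any `b`,
`x^a U(a,b,x) → 1` as real `x → +∞`, i.e. `U(a,b,x) ∼ x^{−a}` (the outgoing normalisation at
infinity). [cite: DLMF, 13.7.3] -/
theorem tendsto_cpow_mul_tricomiU_atTop {a : ℂ} (b : ℂ) (ha : 0 < a.re) :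
    Tendsto (fun x : ℝ => (x : ℂ) ^ a * tricomiU a b x) atTop (𝓝 1) := by
  have hΓ : Complex.Gamma a ≠ 0 := Complex.Gamma_ne_zero_of_re_pos ha
  have h := (tendsto_tricomi_scaledIntegral b ha).div_const (Complex.Gamma a)
  rw [div_self hΓ] at h
  refine h.congr' (Filter.eventually_of_mem (Ioi_mem_atTop 0) fun x (hx : 0 < x) => ?_)
  simp only [tricomiU]
  rw [← tricomiIntegral_ofReal_scaling a b hx, mul_div_assoc]

/-! ### An explicit `O(1/x)` remainder -/

/-- **Mean value bound for the binomial factor**: for real `v ≥ 0` and complex `c`,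
`‖(1+v)^c − 1‖ ≤ ‖c‖ (1+v)^{max(Re c − 1, 0)} v` (`d/dv (1+v)^c = c(1+v)^{c−1}` has modulus
`‖c‖(1+v)^{Re c − 1}`). [folklore] -/
theorem norm_one_add_cpow_sub_one_le (c : ℂ) {v : ℝ} (hv : 0 ≤ v) :
    ‖(1 + (v : ℂ)) ^ c - 1‖ ≤ ‖c‖ * (1 + v) ^ (max (c.re - 1) 0) * v := by
  set q : ℝ := max (c.re - 1) 0 with hq
  have hq0 : 0 ≤ q := le_max_right _ _
  have hderiv : ∀ w ∈ Icc (0 : ℝ) v, HasDerivWithinAt (fun w : ℝ => (1 + (w : ℂ)) ^ c)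
      (c * (1 + (w : ℂ)) ^ (c - 1) * 1) (Icc 0 v) w := fun w hw =>
    ((((hasDerivAt_id' (w : ℂ)).const_add 1).cpow_const
      (one_add_ofReal_mem_slitPlane (by linarith [hw.1]))).comp_ofReal).hasDerivWithinAt
  have hbound : ∀ w ∈ Ico (0 : ℝ) v, ‖c * (1 + (w : ℂ)) ^ (c - 1) * 1‖ ≤ ‖c‖ * (1 + v) ^ q := by
    intro w hw
    have h1 : (1 : ℂ) + (w : ℂ) = ((1 + w : ℝ) : ℂ) := by push_cast; ring
    rw [mul_one, norm_mul, h1, Complex.norm_cpow_eq_rpow_re_of_pos (by linarith [hw.1]),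
      Complex.sub_re, Complex.one_re]
    refine mul_le_mul_of_nonneg_left ?_ (norm_nonneg c)
    calc (1 + w) ^ (c.re - 1) ≤ (1 + w) ^ q :=
          Real.rpow_le_rpow_of_exponent_le (by linarith [hw.1]) (le_max_left _ _)
      _ ≤ (1 + v) ^ q := Real.rpow_le_rpow (by linarith [hw.1]) (by linarith [hw.2]) hq0
  have h := norm_image_sub_le_of_norm_deriv_le_segment' hderiv hbound v (right_mem_Icc.2 hv)
  simpa only [Complex.ofReal_zero, add_zero, Complex.one_cpow, sub_zero] using h

/-- **The remainder of the dominated-convergence limit is `O(1/x)`**: for `Re a > 0`, `x ≥ 1`,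
`‖∫₀^∞ e^{−u}u^{a−1}(1+u/x)^{b−a−1} du − Γ(a)‖ ≤ ‖b−a−1‖ · K / x` with
`K = ∫₀^∞ ‖F(a+1, a+2+q; 1; u)‖ du = ∫₀^∞ e^{−u} u^{Re a}(1+u)^{q} du`, `q = max(Re(b−a−1) − 1, 0)`.
[cite: DLMF, 13.7.3] -/
theorem norm_tricomi_scaledIntegral_sub_Gamma_le {a : ℂ} (b : ℂ) (ha : 0 < a.re) {x : ℝ}
    (hx : 1 ≤ x) :
    ‖(∫ u in Ioi (0 : ℝ), Complex.exp (-(u : ℂ)) * (u : ℂ) ^ (a - 1) *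
        (1 + (u : ℂ) / (x : ℂ)) ^ (b - a - 1)) - Complex.Gamma a‖ ≤
      ‖b - a - 1‖ * (∫ u in Ioi (0 : ℝ),
        ‖tricomiIntegrand (a + 1) (a + 2 + (max ((b - a - 1).re - 1) 0 : ℝ)) 1 u‖) / x := by
  set c : ℂ := b - a - 1 with hc
  set q : ℝ := max (c.re - 1) 0 with hq
  have hq0 : 0 ≤ q := le_max_right _ _
  have hx0 : 0 < x := by linarith
  have ha1 : 0 < (a + 1).re := by simp; linarith
  have hint1 := integrableOn_tricomi_scaledIntegrand b ha hx
  have hint0 : IntegrableOn (fun u : ℝ => Complex.exp (-(u : ℂ)) * (u : ℂ) ^ (a - 1)) (Ioi 0) := by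
    refine (Complex.GammaIntegral_convergent ha).congr_fun (fun u _ => ?_) measurableSet_Ioi
    push_cast
    ring_nf
  have hK : IntegrableOn (fun u : ℝ => ‖tricomiIntegrand (a + 1) (a + 2 + (q : ℂ)) 1 u‖) (Ioi 0) :=
    (integrableOn_tricomiIntegrand _ ha1 (by simp)).norm
  rw [Gamma_eq_integral_exp_mul_cpow ha, ← integral_sub hint1 hint0]
  -- pointwise bound of the difference
  have hpt : ∀ u ∈ Ioi (0 : ℝ), ‖Complex.exp (-(u : ℂ)) * (u : ℂ) ^ (a - 1) *
      (1 + (u : ℂ) / (x : ℂ)) ^ c - Complex.exp (-(u : ℂ)) * (u : ℂ) ^ (a - 1)‖ ≤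
      ‖c‖ * ‖tricomiIntegrand (a + 1) (a + 2 + (q : ℂ)) 1 u‖ / x := by
    intro u hu
    have hu' : 0 < u := hu
    have hv : 1 + (u : ℂ) / (x : ℂ) = 1 + ((u / x : ℝ) : ℂ) := by push_cast; ring
    have hmv := norm_one_add_cpow_sub_one_le c (div_nonneg hu'.le hx0.le : 0 ≤ u / x)
    rw [← mul_sub_one, norm_mul, norm_mul, Complex.norm_exp, Complex.norm_cpow_eq_rpow_re_of_pos hu',
      hv, norm_tricomiIntegrand (a + 1) (a + 2 + q) 1 hu']
    have hre : (a + 2 + (q : ℂ)).re - (a + 1).re - 1 = q := by simp; ring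
    rw [hre]
    simp only [Complex.neg_re, Complex.ofReal_re, Complex.add_re, Complex.one_re, one_mul]
    have hux : u / x ≤ u := div_le_self hu'.le hx
    have h2 : (1 + u / x) ^ q ≤ (1 + u) ^ q := Real.rpow_le_rpow (by positivity) (by linarith) hq0
    have hE : 0 ≤ Real.exp (-u) * u ^ (a.re - 1) := by positivity
    calc Real.exp (-u) * u ^ (a.re - 1) * ‖(1 + ((u / x : ℝ) : ℂ)) ^ c - 1‖
        ≤ Real.exp (-u) * u ^ (a.re - 1) * (‖c‖ * (1 + u) ^ q * (u / x)) := by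
          refine mul_le_mul_of_nonneg_left (hmv.trans ?_) hE
          gcongr
      _ = ‖c‖ * (Real.exp (-u) * u ^ (a.re + 1 - 1) * (1 + u) ^ q) / x := by
          rw [show a.re + 1 - 1 = (a.re - 1) + 1 by ring, Real.rpow_add hu', Real.rpow_one]
          field_simp
  calc ‖∫ u in Ioi (0 : ℝ), Complex.exp (-(u : ℂ)) * (u : ℂ) ^ (a - 1) * (1 + (u : ℂ) / (x : ℂ)) ^ c
        - Complex.exp (-(u : ℂ)) * (u : ℂ) ^ (a - 1)‖
      ≤ ∫ u in Ioi (0 : ℝ), ‖Complex.exp (-(u : ℂ)) * (u : ℂ) ^ (a - 1) * (1 + (u : ℂ) / (x : ℂ)) ^ c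
        - Complex.exp (-(u : ℂ)) * (u : ℂ) ^ (a - 1)‖ := norm_integral_le_integral_norm _
    _ ≤ ∫ u in Ioi (0 : ℝ), ‖c‖ * ‖tricomiIntegrand (a + 1) (a + 2 + (q : ℂ)) 1 u‖ / x :=
        setIntegral_mono_on (hint1.sub hint0).norm ((hK.const_mul _).div_const _)
          measurableSet_Ioi hpt
    _ = ‖c‖ * (∫ u in Ioi (0 : ℝ), ‖tricomiIntegrand (a + 1) (a + 2 + (q : ℂ)) 1 u‖) / x := by
        rw [integral_div, integral_const_mul]

/-- **DLMF 13.7.3, first term with an explicit `O(1/x)` remainder on the real axis**: for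
`Re a > 0` and any `b` there is `C` (namely `‖b−a−1‖·K/‖Γ(a)‖` with `K` as in
`norm_tricomi_scaledIntegral_sub_Gamma_le`) with `‖x^a U(a,b,x) − 1‖ ≤ C/x` for all real `x ≥ 1`.
[cite: DLMF, 13.7.3] -/
theorem norm_cpow_mul_tricomiU_sub_one_le {a : ℂ} (b : ℂ) (ha : 0 < a.re) :
    ∃ C : ℝ, 0 ≤ C ∧ ∀ x : ℝ, 1 ≤ x → ‖(x : ℂ) ^ a * tricomiU a b x - 1‖ ≤ C / x := by
  have hΓ : Complex.Gamma a ≠ 0 := Complex.Gamma_ne_zero_of_re_pos ha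
  have hΓn : 0 < ‖Complex.Gamma a‖ := norm_pos_iff.2 hΓ
  set K : ℝ := ∫ u in Ioi (0 : ℝ),
    ‖tricomiIntegrand (a + 1) (a + 2 + (max ((b - a - 1).re - 1) 0 : ℝ)) 1 u‖ with hK
  have hK0 : 0 ≤ K := integral_nonneg fun _ => norm_nonneg _
  refine ⟨‖b - a - 1‖ * K / ‖Complex.Gamma a‖, by positivity, fun x hx => ?_⟩
  have hx0 : 0 < x := by linarith
  have hJ := norm_tricomi_scaledIntegral_sub_Gamma_le b ha hx
  have heq : (x : ℂ) ^ a * tricomiU a b x - 1 =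
      ((∫ u in Ioi (0 : ℝ), Complex.exp (-(u : ℂ)) * (u : ℂ) ^ (a - 1) *
        (1 + (u : ℂ) / (x : ℂ)) ^ (b - a - 1)) - Complex.Gamma a) / Complex.Gamma a := by
    rw [← tricomiIntegral_ofReal_scaling a b hx0, tricomiU]
    field_simp
  rw [heq, norm_div, div_le_iff₀ hΓn]
  calc _ ≤ ‖b - a - 1‖ * K / x := hJ
    _ = ‖b - a - 1‖ * K / ‖Complex.Gamma a‖ / x * ‖Complex.Gamma a‖ := by field_simp

end Literature.Analysis.SpecialFunctions.Confluent

end
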